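import Literature.NumberTheory.Transcendental.KZProductIdeal
import Literature.NumberTheory.Transcendental.KZSemiCanonicalReductionProofs

/-!
# `BetaCancellation` (stmt-KontsevichZagierPeriods-13633), line `dirichlet-companion-to-pi` — stub `stub_squareFinish`

**The inscribed square finishes.** Let `DQ : IntegralRep 2` be the piece of the unit disc
`D = piDisc` over the square `Q = [-1/2,1/2]²`, with integrand `1`. Since `Q ⊆ D`
(`x² + y² ≤ 1/4 + 1/4 < 1`), `DQ` is the square itself, and `[Q] * c ∼ c` for every formal
combination `c`, inside the Kontsevich–Zagier calculus of moves:

* translate `Q` to the unit square `[0,1]²` (rule (2), `KZ.exists_translate`, Jacobian `1`):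
  `[DQ] − [U] ∈ relations`, hence `[DQ] * c − [U] * c ∈ relations` (right ideal,
  `KZ.mul_mem_relations_right_holds`);
* for a generator `t`: `[U] * [t] ≡ [t] * [U] = [t.prod U]` (commutativity modulo relations,
  `KZ.mul_sub_mul_comm_mem_relations`), and `t.prod U` IS the double slab `(t.slab 0).slab 0`
  (`KZ.IntegralRep.ext'`), which differs from `t` by two Newton–Leibniz moves
  (`KZ.IntegralRep.equivalent_slab`, rule (3));
* biadditivity (`FreeAbelianGroup.induction_on`) gives `[DQ] * c − c ∈ relations` for all `c`,
  so `[DQ] * c ∈ relations → c ∈ relations`.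

No definitions; sorry-free; axioms ⊆ {propext, Classical.choice, Quot.sound}.

References: M. Kontsevich, D. Zagier, *Periods* (2001), §1.2 rules (2)–(3), §4.1.
-/

noncomputable section

-- `Summit.KontsevichZagierPeriods.KontsevichZagierPeriods.…` is the tree's mandated layout (single-conjunct summit).
set_option linter.dupNamespace false

namespace Summit.KontsevichZagierPeriods.KontsevichZagierPeriods.BetaCancellationLine

open Set
open Literature.NumberTheory.Transcendental
open Literature.NumberTheory.Transcendental.KZ

/-! ### §1 The square lies in the disc -/

/-- The square `[-1/2,1/2]²` lies in the closed unit disc: `x² + y² ≤ 1/4 + 1/4 ≤ 1`.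
[folklore] -/
theorem squareFinish_sq_add_sq_le_one {x y : ℝ} (hx : x ∈ Icc (-1/2 : ℝ) (1/2))
    (hy : y ∈ Icc (-1/2 : ℝ) (1/2)) : x ^ 2 + y ^ 2 ≤ 1 := by
  obtain ⟨hx1, hx2⟩ := hx
  obtain ⟨hy1, hy2⟩ := hy
  nlinarith

/-- The piece of the disc over the square `[-1/2,1/2]²` is the square. [folklore] -/
theorem squareFinish_mem_domain_iff (DQ : IntegralRep 2)
    (hD : DQ.domain = piDisc ∩ {z | (z 0, z 1) ∈ Set.Icc (-1/2 : ℝ) (1/2) ×ˢ Set.Icc (-1/2 : ℝ) (1/2)})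
    (z : Fin 2 → ℝ) :
    z ∈ DQ.domain ↔ z 0 ∈ Icc (-1/2 : ℝ) (1/2) ∧ z 1 ∈ Icc (-1/2 : ℝ) (1/2) := by
  rw [hD, mem_inter_iff, mem_piDisc, mem_setOf_eq, mem_prod]
  exact ⟨fun h => h.2, fun h => ⟨squareFinish_sq_add_sq_le_one h.1 h.2, h⟩⟩

/-! ### §2 The unit square times `t` is the double slab over `t` -/

/-- On `ℝ^{n+2} = (ℝⁿ × ℝ) × ℝ`: the leading block is `init ∘ init`. [folklore] -/
theorem squareFinish_init_init {n : ℕ} (z : Fin (n + 2) → ℝ) :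
    Fin.init (Fin.init z) = fun i : Fin n => z (Fin.castAdd 2 i) := rfl

/-- On `ℝ^{n+2}`: the last coordinate of `init z` is the coordinate `n = natAdd n 0`. [folklore] -/
theorem squareFinish_init_last {n : ℕ} (z : Fin (n + 2) → ℝ) :
    Fin.init z (Fin.last n) = z (Fin.natAdd n (0 : Fin 2)) :=
  congrArg z (Fin.ext (by simp))

/-- On `ℝ^{n+2}`: the last coordinate is the coordinate `n + 1 = natAdd n 1`. [folklore] -/
theorem squareFinish_last {n : ℕ} (z : Fin (n + 2) → ℝ) :
    z (Fin.last (n + 1)) = z (Fin.natAdd n (1 : Fin 2)) :=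
  congrArg z (Fin.ext (by simp))

/-- **The unit square times `t` is the double slab over `t`**: if `U = [[0,1]², 1]` then
`t.prod U = (t.slab 0).slab 0` as integral representations (same domain
`σ × [0,1] × [0,1] ⊆ ℝ^{n+2}`, same integrand `f (z|ₙ)`). [folklore] -/
theorem squareFinish_prod_eq_slab_slab {n : ℕ} (t : IntegralRep n) (U : IntegralRep 2)
    (hU : ∀ x : Fin 2 → ℝ, x ∈ U.domain ↔ (0 ≤ x 0 ∧ x 0 ≤ 1) ∧ (0 ≤ x 1 ∧ x 1 ≤ 1))
    (hU1 : ∀ x : Fin 2 → ℝ, U.integrand x = 1) :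
    t.prod U = (t.slab 0).slab 0 := by
  refine IntegralRep.ext' ?_ ?_
  · ext z
    rw [IntegralRep.prod_domain, IntegralRep.mem_prodDomain, hU, IntegralRep.domain_slab]
    simp only [IntegralRep.slabDomain, IntegralRep.domain_slab, mem_setOf_eq, Nat.cast_zero,
      zero_add, squareFinish_init_init, squareFinish_init_last, squareFinish_last]
    tauto
  · rw [IntegralRep.prod_integrand_eq]
    funext z
    simp only [IntegralRep.prodFun_apply, hU1, mul_one, IntegralRep.integrand_slab,
      squareFinish_init_init]

/-- `t` is equivalent to the double slab over it (two Newton–Leibniz moves). [folklore] -/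
theorem squareFinish_equivalent_slab_slab {n : ℕ} (t : IntegralRep n) :
    Equivalent t ((t.slab 0).slab 0) :=
  (t.equivalent_slab 0).trans ((t.slab 0).equivalent_slab 0)

/-- **`[U] * c − c ∈ relations`** for the unit square `U = [[0,1]², 1]` and every formal
combination `c` (generators: commutativity modulo relations and the double slab; then
biadditivity). [folklore] -/
theorem squareFinish_unitSquare_mul_sub_mem_relations (U : IntegralRep 2)
    (hU : ∀ x : Fin 2 → ℝ, x ∈ U.domain ↔ (0 ≤ x 0 ∧ x 0 ≤ 1) ∧ (0 ≤ x 1 ∧ x 1 ≤ 1))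
    (hU1 : ∀ x : Fin 2 → ℝ, U.integrand x = 1) (c : FormalRep) :
    of U * c - c ∈ relations := by
  induction c using FreeAbelianGroup.induction_on with
  | zero => simp [relations.zero_mem]
  | of x =>
    obtain ⟨n, t⟩ := x
    have h1 : of U * of t - of t * of U ∈ relations := mul_sub_mul_comm_mem_relations (of U) (of t)
    have h2 : of t - of t * of U ∈ relations := by
      rw [of_mul_of, squareFinish_prod_eq_slab_slab t U hU hU1]
      exact squareFinish_equivalent_slab_slab t
    have : of U * of t - of t = (of U * of t - of t * of U) - (of t - of t * of U) := by abel
    change of U * of t - of t ∈ relations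
    rw [this]
    exact relations.sub_mem h1 h2
  | neg x ih =>
    have : of U * -FreeAbelianGroup.of x - -FreeAbelianGroup.of x =
        -(of U * FreeAbelianGroup.of x - FreeAbelianGroup.of x) := by
      rw [mul_neg]; abel
    rw [this]
    exact relations.neg_mem ih
  | add x y hx hy =>
    have : of U * (x + y) - (x + y) = (of U * x - x) + (of U * y - y) := by
      rw [mul_add]; abel
    rw [this]
    exact relations.add_mem hx hy

/-! ### §3 The stub -/

/-- **`[DQ] * c − c ∈ relations`**: translate the square `[-1/2,1/2]²` to `[0,1]²` (rule (2),
`KZ.exists_translate`; right ideal) and apply `squareFinish_unitSquare_mul_sub_mem_relations`.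
[folklore] -/
theorem squareFinish_of_mul_sub_mem_relations (DQ : IntegralRep 2)
    (hD : DQ.domain = piDisc ∩ {z | (z 0, z 1) ∈ Set.Icc (-1/2 : ℝ) (1/2) ×ˢ Set.Icc (-1/2 : ℝ) (1/2)})
    (hI : DQ.integrand = fun _ => 1) (c : FormalRep) :
    of DQ * c - c ∈ relations := by
  obtain ⟨U, hUd, hUi, hrel⟩ := exists_translate DQ (fun _ : Fin 2 => (1/2 : ℚ))
  have hhalf : ((1/2 : ℚ) : ℝ) = 1/2 := by norm_num
  have hU : ∀ x : Fin 2 → ℝ, x ∈ U.domain ↔ (0 ≤ x 0 ∧ x 0 ≤ 1) ∧ (0 ≤ x 1 ∧ x 1 ≤ 1) := by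
    intro x
    rw [hUd, mem_preimage, squareFinish_mem_domain_iff DQ hD]
    simp only [Pi.sub_apply, hhalf, mem_Icc]
    constructor
    · rintro ⟨⟨h1, h2⟩, h3, h4⟩
      exact ⟨⟨by linarith, by linarith⟩, by linarith, by linarith⟩
    · rintro ⟨⟨h1, h2⟩, h3, h4⟩
      exact ⟨⟨by linarith, by linarith⟩, by linarith, by linarith⟩
  have hU1 : ∀ x : Fin 2 → ℝ, U.integrand x = 1 := fun x => by rw [hUi, hI]
  have h1 : (of DQ - of U) * c ∈ relations :=
    mul_mem_relations_right_holds _ c (changeOfVariablesRel_subset_relations hrel)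
  have h2 := squareFinish_unitSquare_mul_sub_mem_relations U hU hU1 c
  have : of DQ * c - c = (of DQ - of U) * c + (of U * c - c) := by
    rw [sub_mul]; abel
  rw [this]
  exact relations.add_mem h1 h2

/-- STUB (the inscribed square finishes): the piece of the unit disc over the square
`[-1/2,1/2]²` IS that square, which is worth the constant `1` against any factor:
`[D ∩ Q] * c ∈ relations → c ∈ relations`. [folklore] -/
theorem stub_squareFinish :
    ∀ (DQ : IntegralRep 2), DQ.domain = piDisc ∩ {z | (z 0, z 1) ∈ Set.Icc (-1/2 : ℝ) (1/2) ×ˢ Set.Icc (-1/2 : ℝ) (1/2)} → (DQ.integrand = fun _ => 1) → ∀ c : FormalRep, of DQ * c ∈ relations → c ∈ relations := by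
  intro DQ hD hI c hc
  have h := squareFinish_of_mul_sub_mem_relations DQ hD hI c
  rw [← sub_sub_cancel (of DQ * c) c]
  exact relations.sub_mem hc h

end Summit.KontsevichZagierPeriods.KontsevichZagierPeriods.BetaCancellationLine
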